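import Mathlib
import Summits.ValiantsHypothesis.ValiantsHypothesis.Theorems.TriangularDimersDivisionEasy.Negative.LowerBound

/-!
# Crux `DivisionGap.ZeroOneTransfer` (stmt-ValiantsHypothesis-5066), line `charged-uncharged` —
stub `stub_forbiddenPeel` (D6, PEELING FORBIDDEN EDGES)

For vertex sets `Z`, `W` of the rhombus `R_n` the TYPED dimer covers are the `f ∈ dimers n` with
`∀ x, x ∈ Z ↔ f x ∈ W`.  A typed cover never matches `u` with `v` when the edge `{u, v}` is FORBIDDEN,
`¬((u ∈ Z ↔ v ∈ W) ∧ (v ∈ Z ↔ u ∈ W))` (if `f u = v` then `f v = u`).  Given validly placed gadgets `G`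
with pairwise far centres, each tagged with a forbidden DESIGNATED edge of its ball — the centre edge
`18–25 = uOf–vOf` (tag `true`) or the diagonal `19–25` (tag `false`) — the typed covers are at most a
`((T-1)/T)^|G|` fraction of all dimer covers (`T = Tfib = 6^44`):
`T^|G| · #typed ≤ (T-1)^|G| · #(dimers n)`.

Proof: the fibre argument of `peel_step` / `peel` (Peeling.lean), run for the family of the covers
AVOIDING the designated edge `a g – vOf g` of every tagged gadget `g` of `G`, for an arbitrary
designated-vertex assignment `a` (here `a g = uOf g = vtx 18` for tag `true`, `vtx 19` for tag `false`);
this family contains the typed covers when all designated edges are forbidden (`typed_subset`).  Peel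
the gadgets one at a time (`peel_step_desig`, `peel_desig`): the fibre of a cover `f` avoiding the
designated edges of `g :: G` (the covers agreeing with `f` off the ball of `g`) has at most `T` elements
(`card_fibre_le`), avoids the designated edges of `G` (their ends lie off the ball of `g`,
`not_inBall_of_far`), and contains a cover USING the designated edge of `g` (`desig_cover`): for tag
`true` the cover `f₂` of `exists_two_covers` (inside: `g₀ + {18–25, 12–19}`), for tag `false` the cover
of `exists_cover_diag` (inside: `g₀ + {19–25, 18–12}`, the other local cover of the gadget lemma
`gadget_pm`, re-derived here with its full content).  No `def` is declared.
[folklore]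
-/

open MvPolynomial
open Literature.Computability.AlgebraicComplexity
open Summit.ValiantsHypothesis.ValiantsHypothesis.Theorems.TriangularDimersDivisionEasy.Negative
open scoped NNReal BigOperators
set_option linter.dupNamespace false
noncomputable section
open Classical

namespace Summit.ValiantsHypothesis.ValiantsHypothesis.Theorems.DivisionGapZeroOneTransfer

namespace ForbiddenPeel

variable {n : ℕ} (hn : 0 < n)

/-! ## The other local cover of the gadget: using the diagonal `19–25` -/

/-- **The diagonal cover.**  For a dimer cover `f` and a validly placed ball there is a dimer cover
agreeing with `f` outside the ball and matching `vtx 19` with `vtx 25` (inside: a perfect matching of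
`ball ∖ Q ∖ outS f` from the gadget lemma, extended by the rhombus edges `19–25` and `18–12`).
[folklore] -/
theorem exists_cover_diag (o : Bool) (c : ℤ × ℤ) (f : Vtx n → Vtx n) (hV : Valid n o c)
    (hf : f ∈ dimers n) :
    ∃ f₁ ∈ dimers n, (∀ x, ¬ InBall hn o c x → f₁ x = f x) ∧ f₁ (vtx hn o c 19) = vtx hn o c 25 := by
  -- adapted from `exists_two_covers` (Gluing.lean): its first cover, with the status of `19–25` exported
  obtain ⟨g₀, hg₀⟩ := gadget_pm (outS hn o c f) (fun i hi => (outS_sublist hn o c f).subset hi)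
    (outS_nodup hn o c f) (even_length_outS hn o c f hV hf)
  have hnd0 : (ballMinusQ.filter fun i => !((outS hn o c f).contains i)).Nodup :=
    (List.nodup_range.filter _).filter _
  have hmem0 : ∀ i, i ∈ (ballMinusQ.filter fun i => !((outS hn o c f).contains i)) ↔
      (i < 44 ∧ i ∉ qI) ∧ i ∉ outS hn o c f := by
    intro i
    simp only [ballMinusQ, List.mem_filter, List.mem_range, Bool.not_eq_eq_eq_not, Bool.not_true]
    rw [Bool.eq_false_iff, Bool.eq_false_iff, ne_eq, ne_eq, List.contains_iff_mem, List.contains_iff_mem]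
  have hq : ∀ i ∈ qI, i ∉ (ballMinusQ.filter fun i => !((outS hn o c f).contains i)) := by
    intro i hi h; exact ((hmem0 i).1 h).1.2 hi
  obtain ⟨c1, -, c3, -⟩ := rhombus_cycle
  have h18 : (18 : ℕ) ∈ qI := by decide
  have h25 : (25 : ℕ) ∈ qI := by decide
  have h19 : (19 : ℕ) ∈ qI := by decide
  have h12 : (12 : ℕ) ∈ qI := by decide
  -- non-membership of rhombus indices in the extended lists
  have hq1 : ∀ i ∈ qI, ∀ a : ℕ, i ≠ a →
      i ∉ a :: (ballMinusQ.filter fun i => !((outS hn o c f).contains i)) :=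
    fun i hi a hia => List.not_mem_cons_of_ne_of_not_mem hia (hq i hi)
  have hq2 : ∀ i ∈ qI, ∀ a b : ℕ, i ≠ a → i ≠ b →
      i ∉ a :: b :: (ballMinusQ.filter fun i => !((outS hn o c f).contains i)) :=
    fun i hi a b hia hib => List.not_mem_cons_of_ne_of_not_mem hia (hq1 i hi b hib)
  -- the extension `g₀ + {19–25} + {18–12}`
  have hA := IsPMOn.insert_pair adjI hnd0 hg₀ (hq 19 h19) (hq 25 h25) (by decide) c3 adjI_symm
  have hA' := IsPMOn.insert_pair adjI (List.nodup_cons.2 ⟨hq1 19 h19 25 (by decide), List.nodup_cons.2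
    ⟨hq 25 h25, hnd0⟩⟩) hA (a := 18) (b := 12)
    (hq2 18 h18 19 25 (by decide) (by decide)) (hq2 12 h12 19 25 (by decide) (by decide)) (by decide) c1
    adjI_symm
  -- it is a perfect matching of the inside list (same members)
  have hmemI : ∀ (a b a' b' : ℕ), [a, b, a', b'].Perm qI → ∀ i,
      i ∈ a :: b :: a' :: b' :: (ballMinusQ.filter fun i => !((outS hn o c f).contains i)) ↔
        i ∈ insideL hn o c f := by
    intro a b a' b' hp i
    rw [mem_insideL]
    have hq' : i ∈ qI ↔ i = a ∨ i = b ∨ i = a' ∨ i = b' := by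
      rw [← hp.mem_iff]; simp
    simp only [List.mem_cons, hmem0]
    constructor
    · rintro (rfl | rfl | rfl | rfl | ⟨⟨h1, -⟩, h2⟩)
      · exact (mem_insideL hn o c f).1 (mem_insideL_of_mem_qI hn o c f (hq'.2 (Or.inl rfl)))
      · exact (mem_insideL hn o c f).1 (mem_insideL_of_mem_qI hn o c f (hq'.2 (Or.inr (Or.inl rfl))))
      · exact (mem_insideL hn o c f).1
          (mem_insideL_of_mem_qI hn o c f (hq'.2 (Or.inr (Or.inr (Or.inl rfl)))))
      · exact (mem_insideL hn o c f).1
          (mem_insideL_of_mem_qI hn o c f (hq'.2 (Or.inr (Or.inr (Or.inr rfl)))))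
      · exact ⟨h1, h2⟩
    · rintro ⟨h1, h2⟩
      by_cases hiq : i ∈ qI
      · rcases hq'.1 hiq with h | h | h | h
        · exact Or.inl h
        · exact Or.inr (Or.inl h)
        · exact Or.inr (Or.inr (Or.inl h))
        · exact Or.inr (Or.inr (Or.inr (Or.inl h)))
      · exact Or.inr (Or.inr (Or.inr (Or.inr ⟨⟨h1, hiq⟩, h2⟩)))
  have hgA := IsPMOn.of_mem_iff (hmemI 18 12 19 25 (by decide)) hA'
  refine ⟨glue hn o c f _, glue_mem_dimers hn o c f hV hf hgA,
    fun x hx => glue_apply_of_not_inBall hn o c f _ hx, ?_⟩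
  rw [glue_apply_vtx hn o c f hV _ (mem_insideL_of_mem_qI hn o c f h19)]
  simp

/-! ## Peeling designated edges `a g – vOf g` (generic designated vertex `a g`) -/

/-- **One peeling step** (cf. `peel_step`): if some cover in every fibre of the ball of `g` USES the
edge `a g – vOf g`, and the designated vertices of `G` lie off that ball, then avoiding `a g – vOf g`
on top of the designated edges of `G` costs a factor `(T-1)/T`. [folklore] -/
theorem peel_step_desig (a : Gad × Bool → Vtx n) (g : Gad × Bool) (G : List (Gad × Bool))
    (hcov : ∀ f ∈ dimers n,
      ∃ f' ∈ dimers n, (∀ x, ¬ InBall hn g.1.1 g.1.2 x → f' x = f x) ∧ f' (a g) = vOf hn g.1)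
    (hout : ∀ g' ∈ G, ¬ InBall hn g.1.1 g.1.2 (a g')) :
    Tfib * ((dimers n).filter fun f => ∀ g' ∈ g :: G, f (a g') ≠ vOf hn g'.1).card ≤
      (Tfib - 1) * ((dimers n).filter fun f => ∀ g' ∈ G, f (a g') ≠ vOf hn g'.1).card := by
  -- adapted from `peel_step` (Peeling.lean)
  set S₁ := (dimers n).filter fun f => ∀ g' ∈ g :: G, f (a g') ≠ vOf hn g'.1 with hS₁
  set S₀ := (dimers n).filter fun f => ∀ g' ∈ G, f (a g') ≠ vOf hn g'.1 with hS₀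
  set I := S₁.image (rho hn g.1) with hI
  -- fibres of S₁
  have hsum₁ : S₁.card = ∑ ω ∈ I, (S₁.filter fun f => rho hn g.1 f = ω).card :=
    Finset.card_eq_sum_card_image _ _
  -- whole fibres lie in S₀ and have a missing element
  have hfib_sub : ∀ ω ∈ I, fibre hn g.1 ω ⊆ S₀ := by
    intro ω hω f' hf'
    obtain ⟨f, hf, rfl⟩ := Finset.mem_image.1 hω
    obtain ⟨-, hf⟩ := Finset.mem_filter.1 hf
    obtain ⟨hf'd, hρ⟩ := Finset.mem_filter.1 hf'
    refine Finset.mem_filter.2 ⟨hf'd, fun g' hg' => ?_⟩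
    have := (rho_eq_iff hn).1 hρ (a g') (hout g' hg')
    rw [this]
    exact hf g' (List.mem_cons_of_mem _ hg')
  have hmissing : ∀ ω ∈ I, (S₁.filter fun f => rho hn g.1 f = ω).card + 1 ≤ (fibre hn g.1 ω).card := by
    intro ω hω
    obtain ⟨f, hf, rfl⟩ := Finset.mem_image.1 hω
    have hfd : f ∈ dimers n := (Finset.mem_filter.1 hf).1
    obtain ⟨f', hf'd, ho, heq⟩ := hcov f hfd
    have hρ : rho hn g.1 f' = rho hn g.1 f := (rho_eq_iff hn).2 ho
    have hsub : (S₁.filter fun f'' => rho hn g.1 f'' = rho hn g.1 f) ⊆ fibre hn g.1 (rho hn g.1 f) := by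
      intro f'' hf''
      rw [Finset.mem_filter] at hf''
      exact Finset.mem_filter.2 ⟨(Finset.mem_filter.1 hf''.1).1, hf''.2⟩
    -- `f'` uses the edge `a g – vOf g`: it is in the fibre but not in `S₁`
    have hf'mem : f' ∈ fibre hn g.1 (rho hn g.1 f) := Finset.mem_filter.2 ⟨hf'd, hρ⟩
    have hf'not : f' ∉ (S₁.filter fun f'' => rho hn g.1 f'' = rho hn g.1 f) := fun h =>
      (Finset.mem_filter.1 (Finset.mem_filter.1 h).1).2 g List.mem_cons_self heq
    have hss : (S₁.filter fun f'' => rho hn g.1 f'' = rho hn g.1 f) ⊂ fibre hn g.1 (rho hn g.1 f) :=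
      Finset.ssubset_iff_subset_ne.2 ⟨hsub, fun h => hf'not (h ▸ hf'mem)⟩
    exact Finset.card_lt_card hss
  -- sum up
  have hT : 1 ≤ Tfib := Nat.one_le_pow _ _ (by norm_num)
  have step1 : Tfib * S₁.card ≤ (Tfib - 1) * ∑ ω ∈ I, (fibre hn g.1 ω).card := by
    rw [hsum₁, Finset.mul_sum, Finset.mul_sum]
    apply Finset.sum_le_sum
    intro ω hω
    have h1 := hmissing ω hω
    have h2 := card_fibre_le hn g.1 ω
    -- T * s ≤ (T-1) * F  when s + 1 ≤ F ≤ T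
    have : Tfib * ((S₁.filter fun f => rho hn g.1 f = ω).card + 1) ≤ Tfib * (fibre hn g.1 ω).card :=
      Nat.mul_le_mul_left _ h1
    have h3 : (fibre hn g.1 ω).card ≤ (Tfib - 1) * (fibre hn g.1 ω).card + Tfib := by
      calc (fibre hn g.1 ω).card = 1 * (fibre hn g.1 ω).card := (one_mul _).symm
        _ ≤ (Tfib - 1) * (fibre hn g.1 ω).card + (fibre hn g.1 ω).card := by
            have : 1 * (fibre hn g.1 ω).card ≤
                (Tfib - 1) * (fibre hn g.1 ω).card + 1 * (fibre hn g.1 ω).card :=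
              le_add_self
            rwa [one_mul] at this ⊢
        _ ≤ (Tfib - 1) * (fibre hn g.1 ω).card + Tfib := Nat.add_le_add_left h2 _
    have h4 : Tfib * (fibre hn g.1 ω).card =
        (Tfib - 1) * (fibre hn g.1 ω).card + (fibre hn g.1 ω).card := by
      have : Tfib = (Tfib - 1) + 1 := (Nat.sub_add_cancel hT).symm
      conv_lhs => rw [this]
      ring
    nlinarith [this, h3, h4]
  -- the fibres over I are disjoint parts of S₀
  have step2 : ∑ ω ∈ I, (fibre hn g.1 ω).card ≤ S₀.card := by
    have hdisj : ∑ ω ∈ I, (fibre hn g.1 ω).card = (I.biUnion fun ω => fibre hn g.1 ω).card := by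
      rw [Finset.card_biUnion]
      intro ω _ ω' _ hne
      rw [Function.onFun, Finset.disjoint_left]
      intro f hf hf'
      exact hne ((Finset.mem_filter.1 hf).2.symm.trans (Finset.mem_filter.1 hf').2)
    rw [hdisj]
    apply Finset.card_le_card
    intro f hf
    obtain ⟨ω, hω, hfω⟩ := Finset.mem_biUnion.1 hf
    exact hfib_sub ω hω hfω
  calc Tfib * S₁.card ≤ (Tfib - 1) * ∑ ω ∈ I, (fibre hn g.1 ω).card := step1
    _ ≤ (Tfib - 1) * S₀.card := Nat.mul_le_mul_left _ step2

/-- **Peeling all tagged gadgets** (cf. `peel`): validly placed gadgets with pairwise far centres, a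
designated vertex `a g` in the ball of `g`, and a cover using `a g – vOf g` in every fibre. [folklore] -/
theorem peel_desig (a : Gad × Bool → Vtx n) (ha : ∀ g : Gad × Bool, InBall hn g.1.1 g.1.2 (a g))
    (hcov : ∀ g : Gad × Bool, Valid n g.1.1 g.1.2 → ∀ f ∈ dimers n,
      ∃ f' ∈ dimers n, (∀ x, ¬ InBall hn g.1.1 g.1.2 x → f' x = f x) ∧ f' (a g) = vOf hn g.1) :
    ∀ (G : List (Gad × Bool)), (∀ g ∈ G, Valid n g.1.1 g.1.2) → (G.map Prod.fst).Pairwise Far →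
      Tfib ^ G.length * ((dimers n).filter fun f => ∀ g ∈ G, f (a g) ≠ vOf hn g.1).card ≤
        (Tfib - 1) ^ G.length * (dimers n).card := by
  intro G
  induction G with
  | nil => intro _ _; simp
  | cons g G ih =>
    intro hV hfar
    have hVg : Valid n g.1.1 g.1.2 := hV g List.mem_cons_self
    have hVG : ∀ g' ∈ G, Valid n g'.1.1 g'.1.2 := fun g' hg' => hV g' (List.mem_cons_of_mem _ hg')
    rw [List.map_cons, List.pairwise_cons] at hfar
    have hout : ∀ g' ∈ G, ¬ InBall hn g.1.1 g.1.2 (a g') := by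
      intro g' hg' hin
      have hfar' : Far g.1 g'.1 := hfar.1 g'.1 (List.mem_map.2 ⟨g', hg', rfl⟩)
      exact not_inBall_of_far hn hfar' hVg (hVG g' hg') hin (ha g')
    have h1 := peel_step_desig hn a g G (hcov g hVg) hout
    have h2 := ih hVG hfar.2
    calc Tfib ^ (g :: G).length * ((dimers n).filter fun f => ∀ g' ∈ g :: G, f (a g') ≠ vOf hn g'.1).card
        = Tfib ^ G.length *
            (Tfib * ((dimers n).filter fun f => ∀ g' ∈ g :: G, f (a g') ≠ vOf hn g'.1).card) := by
          rw [List.length_cons, pow_succ]; ring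
      _ ≤ Tfib ^ G.length *
            ((Tfib - 1) * ((dimers n).filter fun f => ∀ g' ∈ G, f (a g') ≠ vOf hn g'.1).card) :=
          Nat.mul_le_mul_left _ h1
      _ = (Tfib - 1) *
            (Tfib ^ G.length * ((dimers n).filter fun f => ∀ g' ∈ G, f (a g') ≠ vOf hn g'.1).card) := by
          ring
      _ ≤ (Tfib - 1) * ((Tfib - 1) ^ G.length * (dimers n).card) := Nat.mul_le_mul_left _ h2
      _ = (Tfib - 1) ^ (g :: G).length * (dimers n).card := by rw [List.length_cons, pow_succ]; ring

/-- A typed cover (`∀ x, x ∈ Z ↔ f x ∈ W`) avoids every FORBIDDEN designated edge `a g – vOf g`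
(if `f (a g) = vOf g` then `f (vOf g) = a g`, and the edge would be allowed). [folklore] -/
theorem typed_subset (a : Gad × Bool → Vtx n) (Z W : Finset (Fin n × Fin n)) (G : List (Gad × Bool))
    (hforb : ∀ g ∈ G, ¬ ((a g ∈ Z ↔ vOf hn g.1 ∈ W) ∧ (vOf hn g.1 ∈ Z ↔ a g ∈ W))) :
    ((dimers n).filter fun f => ∀ x : Fin n × Fin n, (x ∈ Z ↔ f x ∈ W)) ⊆
      (dimers n).filter fun f => ∀ g ∈ G, f (a g) ≠ vOf hn g.1 := by
  intro f hf
  rw [Finset.mem_filter] at hf ⊢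
  refine ⟨hf.1, fun g hg heq => hforb g hg ?_⟩
  have hd : IsDimer f := (Finset.mem_filter.1 hf.1).2
  -- `f` matches `a g` with `vOf g`, hence `vOf g` with `a g`
  have heq' : f (vOf hn g.1) = a g := by rw [← heq, (hd _).1]
  have h1 := hf.2 (a g)
  have h2 := hf.2 (vOf hn g.1)
  rw [heq] at h1
  rw [heq'] at h2
  exact ⟨h1, h2⟩

/-! ## The designated vertex of a tagged gadget: `uOf = vtx 18` (tag `true`) or `vtx 19` (tag `false`) -/

/-- The designated vertex lies in the ball of its gadget. [folklore] -/
theorem desig_inBall (g : Gad × Bool) :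
    InBall hn g.1.1 g.1.2 (bif g.2 then uOf hn g.1 else vtx hn g.1.1 g.1.2 19) := by
  obtain ⟨g₁, b⟩ := g
  cases b
  · exact inBall_vtx hn g₁.1 g₁.2 (i := 19) (by norm_num)
  · exact inBall_vtx hn g₁.1 g₁.2 (i := 18) (by norm_num)

/-- In every fibre of the ball of a validly placed tagged gadget some dimer cover USES the designated
edge: `18–25` (`exists_two_covers`) resp. `19–25` (`exists_cover_diag`). [folklore] -/
theorem desig_cover (g : Gad × Bool) (hV : Valid n g.1.1 g.1.2) (f : Vtx n → Vtx n)
    (hf : f ∈ dimers n) :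
    ∃ f' ∈ dimers n, (∀ x, ¬ InBall hn g.1.1 g.1.2 x → f' x = f x) ∧
      f' (bif g.2 then uOf hn g.1 else vtx hn g.1.1 g.1.2 19) = vOf hn g.1 := by
  obtain ⟨g₁, b⟩ := g
  cases b
  · obtain ⟨f₁, hf₁, ho₁, h19⟩ := exists_cover_diag hn g₁.1 g₁.2 f hV hf
    exact ⟨f₁, hf₁, ho₁, h19⟩
  · obtain ⟨f₁, -, f₂, hf₂, -, ho₂, -, heq⟩ := exists_two_covers hn g₁.1 g₁.2 f hV hf
    exact ⟨f₂, hf₂, ho₂, heq⟩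

end ForbiddenPeel

open ForbiddenPeel in
/-- **Stub D6 — PEELING FORBIDDEN EDGES.**  The dimer covers respecting the type `(Z, W)`
(`∀ x, x ∈ Z ↔ f x ∈ W`) are at most a `((T-1)/T)^|G|` fraction of all covers, for every list `G` of
validly placed pairwise far gadgets each carrying a forbidden designated edge (centre `18–25`, tag
`true`, or diagonal `19–25`, tag `false`).  Same fibre argument as `peel`/`peel_step`, for the family
"avoids the designated edge of every gadget of `G`" (which contains the typed covers); the missing
cover in each fibre is one of the two local covers of `exists_two_covers` (re-derived with its full
content: `f₂` uses `18–25` and `12–19`, `f₁` uses `18–12` and `19–25`). [folklore] -/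
theorem stub_forbiddenPeel :
    ∀ (n : ℕ) (hn : 0 < n) (Z W : Finset (Fin n × Fin n)) (G : List (Gad × Bool)),
      (∀ g ∈ G, Valid n g.1.1 g.1.2) → (G.map Prod.fst).Pairwise Far →
      (∀ g ∈ G,
          (g.2 = true → ¬ ((uOf hn g.1 ∈ Z ↔ vOf hn g.1 ∈ W) ∧ (vOf hn g.1 ∈ Z ↔ uOf hn g.1 ∈ W))) ∧
          (g.2 = false → ¬ ((vtx hn g.1.1 g.1.2 19 ∈ Z ↔ vtx hn g.1.1 g.1.2 25 ∈ W) ∧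
                           (vtx hn g.1.1 g.1.2 25 ∈ Z ↔ vtx hn g.1.1 g.1.2 19 ∈ W)))) →
      Tfib ^ G.length * ((dimers n).filter (fun f => ∀ x : Fin n × Fin n, (x ∈ Z ↔ f x ∈ W))).card ≤
        (Tfib - 1) ^ G.length * (dimers n).card := by
  intro n hn Z W G hV hfar hforb
  -- every designated edge (`uOf–vOf` for tag `true`, `vtx 19–vOf` for tag `false`) is forbidden
  have hforb' : ∀ g ∈ G,
      ¬ (((bif g.2 then uOf hn g.1 else vtx hn g.1.1 g.1.2 19) ∈ Z ↔ vOf hn g.1 ∈ W) ∧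
         (vOf hn g.1 ∈ Z ↔ (bif g.2 then uOf hn g.1 else vtx hn g.1.1 g.1.2 19) ∈ W)) := by
    rintro ⟨g₁, b⟩ hg
    obtain ⟨htrue, hfalse⟩ := hforb _ hg
    cases b
    · exact hfalse rfl
    · exact htrue rfl
  calc Tfib ^ G.length * ((dimers n).filter (fun f => ∀ x : Fin n × Fin n, (x ∈ Z ↔ f x ∈ W))).card
      ≤ Tfib ^ G.length * ((dimers n).filter fun f => ∀ g ∈ G,
          f (bif g.2 then uOf hn g.1 else vtx hn g.1.1 g.1.2 19) ≠ vOf hn g.1).card :=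
        Nat.mul_le_mul_left _ (Finset.card_le_card
          (typed_subset hn (fun g => bif g.2 then uOf hn g.1 else vtx hn g.1.1 g.1.2 19) Z W G hforb'))
    _ ≤ (Tfib - 1) ^ G.length * (dimers n).card :=
        peel_desig hn (fun g => bif g.2 then uOf hn g.1 else vtx hn g.1.1 g.1.2 19)
          (desig_inBall hn) (desig_cover hn) G hV hfar

end Summit.ValiantsHypothesis.ValiantsHypothesis.Theorems.DivisionGapZeroOneTransfer

end
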